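import Summits.Ventures.LatticeQCDFlow.Scoring.SlidingWindowChain
import Summits.Ventures.LatticeQCDFlow.Exactness.NCMCGeneralSpaceDoeblinPowerEveryStart
import Summits.Ventures.LatticeQCDFlow.Scoring.BlockFactorStrongLaw
import Summits.Ventures.LatticeQCDFlow.Scoring.SplitChainFreshPairMoments

/-!
# The STRONG LAW for window functionals of a chain with a Doeblin power, from EVERY initial law:
# `(1/n) Σ_{i<n} φ(X_i, …, X_{i+W}) → E_π φ(Y_0)` almost surely; hence the known-mean empirical
# autocovariances and the windowed `τ_int` estimate are a.s. consistent and the Madras–Sokal window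
# freezes almost surely

HONEST FRAMING: exact (Metropolis-corrected) sampling algorithms for lattice gauge theory;
figures of merit are autocorrelation/cost numbers at stated couplings and volumes; no
continuum-physics claim.

Venture `LatticeQCDFlow` (cell pub-lqcd), sub-topic `Scoring`; FANOUT row 16 (`su2-base`), GEN-9.
NEW WORK of the cell, not a published result; no definition; nothing is cited as a fact.  ASSEMBLY of
row 13's every-start strong law under a Doeblin power
(`Exactness/NCMCGeneralSpaceDoeblinPowerEveryStart.tendsto_sum_div_anyLaw_of_nHit_minorised`: shift-invariant
events of full `P_π`-measure have full `P_{μ₀}`-measure) with GEN-9's sliding-window chain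
(`Scoring/SlidingWindowChain`): the window chain has a Doeblin power and invariant law `π_W`, and the
window path under `P_{μ₀}` IS that chain, so the strong law transfers to functionals of `W + 1`
consecutive states.  MARKOV-CHAIN COUNTERPART of GEN-8's `Scoring/BlockFactorStrongLaw` (there for
finite-range functionals of an i.i.d. sequence), whose abstract freezing lemma `ae_eventually_isMSWindow`
is reused verbatim.

## Content (`κ` Markov, `π` invariant, `(nHit κ m)(z,·) ≥ ε ν` for all `z`, `ε ≠ 0`; `φ` bounded
## measurable on windows; `|f| ≤ C` measurable, `f̄ = f − ∫ f dπ`, `C(t) = autocov κ π f̄ t`; `μ₀` ANY law)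

* **`ae_tendsto_windowAverage_of_nHit`** — `(1/n) Σ_{i<n} φ(windowPath W x i) → E_{P_π} φ(Y_0)` for
  `P_{μ₀}`-a.e. path `x`;
* **`ae_tendsto_chain_acovHat_of_nHit`** — every known-mean empirical autocovariance of `f̄` along the
  chain is a.s. consistent: `acovHat (f̄ ∘ X) N t → C(t)` `P_{μ₀}`-a.s.;
* **`ae_tendsto_chain_tauIntWindow_of_nHit`** — `C(0) ≠ 0`: a.s., for EVERY window `W` at once,
  `tauIntWindow (Γ̂_N(·)/Γ̂_N(0)) W → τ_W = tauIntWindow (C(·)/C(0)) W`;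
* **`ae_eventually_isMSWindow_chain_of_nHit`** — at a strict population crossing (`c > 0`), almost
  surely `w` IS the Madras–Sokal window of the empirical known-mean curve for all large `N`.

NOT CLAIMED: the scorers' centred `1/(N−t)` curve (its a.s. consistency needs the expansion of GEN-8's
`BlockFactorStrongLawCentred`, same argument; not restated here); rates (no law of the iterated logarithm);
unbounded `φ`.
-/

noncomputable section

open MeasureTheory ProbabilityTheory Filter Finset Preorder
open scoped ENNReal Topology
open Summit.Ventures.LatticeQCDFlow.Exactness Summit.Ventures.LatticeQCDFlow.Exactness.GeneralNCMC

namespace Summit.Ventures.LatticeQCDFlow.Scoring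

variable {S : Type*} [MeasurableSpace S]

section SLLN

variable (κ : Kernel S S) [IsMarkovKernel κ] (W : ℕ) {π : Measure S} [IsProbabilityMeasure π]
  {ν : Measure S} [IsProbabilityMeasure ν] {ε : ℝ≥0∞} {m : ℕ}

/-- **THE STRONG LAW FOR WINDOW FUNCTIONALS, FROM ANY INITIAL LAW.**  `κ` Markov with invariant
probability `π` and `(nHit κ m)(z, ·) ≥ ε ν` for all `z` (`ε ≠ 0`); `φ` bounded measurable on windows of
length `W + 1`.  For EVERY initial law `μ₀`, for `P_{μ₀}`-almost every path `x`:
`(1/n) Σ_{i<n} φ(x_i, …, x_{i+W}) → ∫ φ(windowPath W x' 0) dP_π(x')`. -/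
theorem ae_tendsto_windowAverage_of_nHit (hπ : Kernel.Invariant κ π) (hε : ε ≠ 0)
    (hmin : ∀ z, ε • ν ≤ nHit κ m z) {φ : (Fin (W + 1) → S) → ℝ} (hφ : Measurable φ) {C : ℝ}
    (hC : ∀ v, |φ v| ≤ C) (μ₀ : Measure S) [IsProbabilityMeasure μ₀] :
    ∀ᵐ x ∂(Kernel.trajMeasure (X := fun _ : ℕ => S) μ₀
        (fun n : ℕ => κ.comap (fun hh : (i : ↥(Finset.Iic n)) → S => hh ⟨n, Finset.mem_Iic.2 le_rfl⟩)
          (measurable_pi_apply _))),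
      Tendsto (fun n : ℕ => (∑ i ∈ range n, φ (windowPath W x i)) / n) atTop
        (𝓝 (∫ x', φ (windowPath W x' 0) ∂(Kernel.trajMeasure (X := fun _ : ℕ => S) π
          (fun n : ℕ => κ.comap (fun hh : (i : ↥(Finset.Iic n)) → S => hh ⟨n, Finset.mem_Iic.2 le_rfl⟩)
            (measurable_pi_apply _))))) := by
  set P := Kernel.trajMeasure (X := fun _ : ℕ => S) μ₀
    (fun n : ℕ => κ.comap (fun hh : (i : ↥(Finset.Iic n)) → S => hh ⟨n, Finset.mem_Iic.2 le_rfl⟩)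
      (measurable_pi_apply _)) with hP
  set Pπ := Kernel.trajMeasure (X := fun _ : ℕ => S) π
    (fun n : ℕ => κ.comap (fun hh : (i : ↥(Finset.Iic n)) → S => hh ⟨n, Finset.mem_Iic.2 le_rfl⟩)
      (measurable_pi_apply _)) with hPπ
  haveI hπWp : IsProbabilityMeasure (Pπ.map (fun x : ℕ → S => windowPath W x 0)) :=
    Measure.isProbabilityMeasure_map (measurable_windowPath_at 0).aemeasurable
  haveI hνWp : IsProbabilityMeasure ((Kernel.trajMeasure (X := fun _ : ℕ => S) ν
      (fun n : ℕ => κ.comap (fun hh : (i : ↥(Finset.Iic n)) → S => hh ⟨n, Finset.mem_Iic.2 le_rfl⟩)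
        (measurable_pi_apply _))).map (fun x : ℕ → S => windowPath W x 0)) :=
    Measure.isProbabilityMeasure_map (measurable_windowPath_at 0).aemeasurable
  haveI hμWp : IsProbabilityMeasure (P.map (fun x : ℕ → S => windowPath W x 0)) :=
    Measure.isProbabilityMeasure_map (measurable_windowPath_at 0).aemeasurable
  have hπW : Kernel.Invariant (windowKernel κ W) (Pπ.map (fun x : ℕ → S => windowPath W x 0)) := by
    rw [hPπ]; exact invariant_windowKernel κ W hπ
  have hminW : ∀ y, ε • ((Kernel.trajMeasure (X := fun _ : ℕ => S) ν
      (fun n : ℕ => κ.comap (fun hh : (i : ↥(Finset.Iic n)) → S => hh ⟨n, Finset.mem_Iic.2 le_rfl⟩)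
        (measurable_pi_apply _))).map (fun x : ℕ → S => windowPath W x 0))
      ≤ nHit (windowKernel κ W) (m + W) y := windowKernel_minorised_of_nHit κ W hmin
  -- the strong law along the window chain, from the initial-window law
  have hslln := tendsto_sum_div_anyLaw_of_nHit_minorised (κ := windowKernel κ W) hπW hε hminW hφ
    (integrable_of_bounded _ hφ hC) (P.map (fun x : ℕ → S => windowPath W x 0))
  rw [integral_map (measurable_windowPath_at 0).aemeasurable hφ.aestronglyMeasurable, hP,
    ← chain_map_windowPath κ W μ₀, ← hP] at hslln
  exact (ae_map_iff (measurable_windowPath W).aemeasurable (measurableSet_cesaroSet hφ _)).1 hslln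

/-! ## Almost-sure consistency of the known-mean autocovariance estimates along the chain -/

/-- **`Γ̂_N(t) → C(t)` almost surely, from every initial law**, for the known-mean empirical
autocovariance `acovHat (f̄ ∘ X) N t` of a bounded observable (`t` arbitrary). -/
theorem ae_tendsto_chain_acovHat_of_nHit (hπ : Kernel.Invariant κ π) (hε : ε ≠ 0)
    (hmin : ∀ z, ε • ν ≤ nHit κ m z) {f : S → ℝ} (hf : Measurable f) {C : ℝ} (hC : ∀ z, |f z| ≤ C)
    (μ₀ : Measure S) [IsProbabilityMeasure μ₀] (t : ℕ) :
    ∀ᵐ x ∂(Kernel.trajMeasure (X := fun _ : ℕ => S) μ₀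
        (fun n : ℕ => κ.comap (fun hh : (i : ↥(Finset.Iic n)) → S => hh ⟨n, Finset.mem_Iic.2 le_rfl⟩)
          (measurable_pi_apply _))),
      Tendsto (fun N : ℕ => acovHat (fun (i : ℕ) (x : ℕ → S) => f (x i) - ∫ z', f z' ∂π) N t x) atTop
        (𝓝 (autocov κ π (fun z => f z - ∫ z', f z' ∂π) t)) := by
  obtain ⟨hgm, hgC, -⟩ := centred_observable_bounds π hf hC
  -- the lag-`t` product read on a window of length `t + 1`
  have hφm : Measurable fun y : Fin (t + 1) → S =>
      (f (y 0) - ∫ z', f z' ∂π) * (f (y (Fin.last t)) - ∫ z', f z' ∂π) :=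
    (hgm.comp (measurable_pi_apply 0)).mul (hgm.comp (measurable_pi_apply _))
  have hφC : ∀ y : Fin (t + 1) → S,
      |(f (y 0) - ∫ z', f z' ∂π) * (f (y (Fin.last t)) - ∫ z', f z' ∂π)| ≤ 2 * C * (2 * C) := fun y => by
    rw [abs_mul]
    exact mul_le_mul (hgC _) (hgC _) (abs_nonneg _) ((abs_nonneg _).trans (hgC (y 0)))
  have h := ae_tendsto_windowAverage_of_nHit κ t hπ hε hmin hφm hφC μ₀
  have hcen : ∫ x', (f (windowPath t x' 0 0) - ∫ z', f z' ∂π)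
      * (f (windowPath t x' 0 (Fin.last t)) - ∫ z', f z' ∂π)
      ∂(Kernel.trajMeasure (X := fun _ : ℕ => S) π
        (fun n : ℕ => κ.comap (fun hh : (i : ↥(Finset.Iic n)) → S => hh ⟨n, Finset.mem_Iic.2 le_rfl⟩)
          (measurable_pi_apply _))) = autocov κ π (fun z => f z - ∫ z', f z' ∂π) t := by
    simp only [windowPath_apply, Fin.val_zero, Fin.val_last, Nat.add_zero]
    exact chain_autocov hπ hgm hgC 0 t
  rw [hcen] at h
  filter_upwards [h] with x hx
  refine hx.congr fun N => ?_
  simp only [acovHat_apply, windowPath_apply, Fin.val_zero, Fin.val_last, Nat.add_zero]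

/-- **`τ̂_N(W) → τ_W` almost surely for EVERY window at once, from every initial law** (known-mean
curve; `C(0) ≠ 0`). -/
theorem ae_tendsto_chain_tauIntWindow_of_nHit (hπ : Kernel.Invariant κ π) (hε : ε ≠ 0)
    (hmin : ∀ z, ε • ν ≤ nHit κ m z) {f : S → ℝ} (hf : Measurable f) {C : ℝ} (hC : ∀ z, |f z| ≤ C)
    (hσ : autocov κ π (fun z => f z - ∫ z', f z' ∂π) 0 ≠ 0) (μ₀ : Measure S) [IsProbabilityMeasure μ₀] :
    ∀ᵐ x ∂(Kernel.trajMeasure (X := fun _ : ℕ => S) μ₀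
        (fun n : ℕ => κ.comap (fun hh : (i : ↥(Finset.Iic n)) → S => hh ⟨n, Finset.mem_Iic.2 le_rfl⟩)
          (measurable_pi_apply _))),
      ∀ W' : ℕ, Tendsto (fun N : ℕ => tauIntWindow (fun t =>
          acovHat (fun (i : ℕ) (x : ℕ → S) => f (x i) - ∫ z', f z' ∂π) N t x
            / acovHat (fun (i : ℕ) (x : ℕ → S) => f (x i) - ∫ z', f z' ∂π) N 0 x) W') atTop
        (𝓝 (tauIntWindow (fun t => autocov κ π (fun z => f z - ∫ z', f z' ∂π) t
          / autocov κ π (fun z => f z - ∫ z', f z' ∂π) 0) W')) := by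
  have hall := ae_all_iff.2 fun t : ℕ => ae_tendsto_chain_acovHat_of_nHit κ hπ hε hmin hf hC μ₀ t
  filter_upwards [hall] with x hx
  intro W'
  have hρ : ∀ t, Tendsto (fun N : ℕ => acovHat (fun (i : ℕ) (x : ℕ → S) => f (x i) - ∫ z', f z' ∂π) N t x
      / acovHat (fun (i : ℕ) (x : ℕ → S) => f (x i) - ∫ z', f z' ∂π) N 0 x) atTop
      (𝓝 (autocov κ π (fun z => f z - ∫ z', f z' ∂π) t
        / autocov κ π (fun z => f z - ∫ z', f z' ∂π) 0)) := fun t => (hx t).div (hx 0) hσ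
  unfold tauIntWindow
  exact tendsto_const_nhds.add (tendsto_finsetSum _ fun t _ => hρ (t + 1))

/-- **THE MADRAS–SOKAL WINDOW OF THE KNOWN-MEAN CURVE FREEZES ALMOST SURELY ON CHAIN DATA**: if the
population curve `W ↦ τ_W` has a STRICT Madras–Sokal window `w` at `c > 0`, then from every initial law,
almost surely `w` is the MS window of the empirical curve for all large `N` (GEN-8's abstract
`ae_eventually_isMSWindow`). -/
theorem ae_eventually_isMSWindow_chain_of_nHit (hπ : Kernel.Invariant κ π) (hε : ε ≠ 0)
    (hmin : ∀ z, ε • ν ≤ nHit κ m z) {f : S → ℝ} (hf : Measurable f) {C : ℝ} (hC : ∀ z, |f z| ≤ C)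
    (hσ : autocov κ π (fun z => f z - ∫ z', f z' ∂π) 0 ≠ 0) {c : ℝ} (hc : 0 < c) {w : ℕ}
    (hw : IsStrictMSWindow c (fun W' => tauIntWindow (fun t =>
      autocov κ π (fun z => f z - ∫ z', f z' ∂π) t / autocov κ π (fun z => f z - ∫ z', f z' ∂π) 0) W') w)
    (μ₀ : Measure S) [IsProbabilityMeasure μ₀] :
    ∀ᵐ x ∂(Kernel.trajMeasure (X := fun _ : ℕ => S) μ₀
        (fun n : ℕ => κ.comap (fun hh : (i : ↥(Finset.Iic n)) → S => hh ⟨n, Finset.mem_Iic.2 le_rfl⟩)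
          (measurable_pi_apply _))),
      ∀ᶠ N in atTop, IsMSWindow c (fun W' => tauIntWindow (fun t =>
        acovHat (fun (i : ℕ) (x : ℕ → S) => f (x i) - ∫ z', f z' ∂π) N t x
          / acovHat (fun (i : ℕ) (x : ℕ → S) => f (x i) - ∫ z', f z' ∂π) N 0 x) W') w :=
  ae_eventually_isMSWindow (τhat := fun (N W' : ℕ) (x : ℕ → S) => tauIntWindow (fun t =>
      acovHat (fun (i : ℕ) (x : ℕ → S) => f (x i) - ∫ z', f z' ∂π) N t x
        / acovHat (fun (i : ℕ) (x : ℕ → S) => f (x i) - ∫ z', f z' ∂π) N 0 x) W') hc hw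
    (ae_tendsto_chain_tauIntWindow_of_nHit κ hπ hε hmin hf hC hσ μ₀)

end SLLN

end Summit.Ventures.LatticeQCDFlow.Scoring

end
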